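import Summits.ValiantsHypothesis.ValiantsHypothesis.Theorems.NewtonUnitEquationsTwoProductsSubmergedTruncation
import Summits.ValiantsHypothesis.ValiantsHypothesis.Theorems.NewtonUnitEquationsTwoProductsPlanarCellCharging

/-!
# K4 `submerged-band-filtration` — tools for the HIGH-LETTER PAIRING (L4): restriction to a letter set, graded fibre sums

Tool file for `highLetterPairing_holds` (val-idea-36 g0's L4 «Newton–Vieta pairing of the high letters»).
* `keepSet u H`: the restriction of every tail to the letters of `H` (complementary to `dropSet`); its extended coefficients
  `hatCoeff` agree with those of `u` on `H ∪ {0}` (`hatCoeff_keepSet`).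
* GRADED PRODUCT EXPANSION (`esymm_eq_sum_tuples`): the elementary symmetric polynomial OF THE TAILS
  `Σ_{|J| = r} ∏_{j ∈ J} w_j` is the sum, over the letter tuples `b ∈ ∏_j (A ∪ {0})` with exactly `r` non-zero slots, of
  `(∏_j ŵ_j(b_j)) · X^{Σ_j b_j}` — the `r`-graded piece of the landed `PlanarCell.prod_one_add_eq`; hence its coefficient at a point
  `p` is the GRADED FIBRE SUM over the tuples with point `p` and `r` non-zero slots (`coeff_esymm_eq_fibreSum`).
* rearrangements preserve the number of non-zero slots (`card_support_comp_perm`).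
Helper mode (`--supports stmt-ValiantsHypothesis-5906 --as helper`).  Honest framing: bookkeeping for an infrastructure lemma; nothing
here closes 5906 (`TwoProducts` / `ResidualLawV23` / `PlanarCellBound` OPEN); VP ≠ VNP is NOT proved.  No instances, no notation, no
named facts. [folklore]
-/

noncomputable section
set_option linter.dupNamespace false

namespace Summit.ValiantsHypothesis.ValiantsHypothesis.Theorems.NewtonUnitEquations.TwoProducts.Submerged
open scoped BigOperators
open MvPolynomial
open Summit.ValiantsHypothesis.ValiantsHypothesis.Theorems.NewtonUnitEquations.TwoProducts.FormalLogLinearisation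
open Summit.ValiantsHypothesis.ValiantsHypothesis.Theorems.NewtonUnitEquations.TwoProducts.PlanarCell

variable {m : ℕ}

/-! ## Restriction of the tails to a letter set -/

/-- Restriction to a SET of letters: keep only the monomials `X^e`, `e ∈ H`, of every tail. [folklore] -/
def keepSet (u : Fin m → MvPolynomial (Fin 2) ℂ) (H : Finset Expo) : Fin m → MvPolynomial (Fin 2) ℂ :=
  fun j => ∑ e ∈ H, monomial e (coeff e (u j))

/-- Coefficients of the restricted tail. [folklore] -/
theorem coeff_keepSet (u : Fin m → MvPolynomial (Fin 2) ℂ) (H : Finset Expo) (x : Expo) (j : Fin m) :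
    coeff x (keepSet u H j) = if x ∈ H then coeff x (u j) else 0 := by
  unfold keepSet
  exact coeff_sum_monomial (u j) H x

/-- The support of the restricted tail lies in `H` and in the old support. [folklore] -/
theorem support_keepSet_subset (u : Fin m → MvPolynomial (Fin 2) ℂ) (H : Finset Expo) (j : Fin m) :
    (keepSet u H j).support ⊆ (u j).support ∩ H := by
  classical
  intro x hx
  rw [mem_support_iff, coeff_keepSet] at hx
  by_cases h : x ∈ H
  · rw [if_pos h] at hx
    exact Finset.mem_inter.2 ⟨mem_support_iff.2 hx, h⟩
  · exact absurd (if_neg h) hx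

/-- Extended coefficients (`ŵ(0) = 1`, `ŵ(e) = [X^e] w`) of the restricted tail agree with the original ones on `H ∪ {0}`. [folklore] -/
theorem hatCoeff_keepSet (u : Fin m → MvPolynomial (Fin 2) ℂ) (H : Finset Expo) (j : Fin m) {x : Expo}
    (hx : x ∈ insert (0 : Expo) H) : hatCoeff (keepSet u H j) x = hatCoeff (u j) x := by
  classical
  unfold hatCoeff
  split_ifs with h0
  · rfl
  · rw [coeff_keepSet, if_pos ((Finset.mem_insert.1 hx).resolve_left h0)]

/-- On tuples over `H ∪ {0}` the tuple weights `∏_j ŵ_j(b_j)` of `u` and of its restriction to `H` agree. [folklore] -/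
theorem prod_hatCoeff_keepSet (u : Fin m → MvPolynomial (Fin 2) ℂ) (H : Finset Expo) {b : Fin m → Expo}
    (hb : b ∈ Fintype.piFinset fun _ : Fin m => insert (0 : Expo) H) :
    ∏ j, hatCoeff (keepSet u H j) (b j) = ∏ j, hatCoeff (u j) (b j) :=
  Finset.prod_congr rfl fun j _ => hatCoeff_keepSet u H j (Fintype.mem_piFinset.1 hb j)

/-! ## The graded product expansion -/

/-- A partial product of tails is the sum of the tuple monomials over the tuples supported EXACTLY on `J`. [folklore] -/
theorem prod_eq_sum_tuples (w : Fin m → MvPolynomial (Fin 2) ℂ) (A : Finset Expo) (h0 : (0 : Expo) ∉ A)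
    (hw : ∀ j, (w j).support ⊆ A) (J : Finset (Fin m)) :
    ∏ j ∈ J, w j = ∑ b ∈ (Fintype.piFinset fun _ : Fin m => insert (0 : Expo) A).filter
        (fun b => (Finset.univ.filter fun j => b j ≠ 0) = J), monomial (∑ j, b j) (∏ j, hatCoeff (w j) (b j)) := by
  classical
  -- the slot sets: `A` on `J`, `{0}` off `J`
  set B : Fin m → Finset Expo := fun j => if j ∈ J then A else {0} with hB
  have hprod : ∏ j ∈ J, w j = ∏ j, ∑ e ∈ B j, monomial e (hatCoeff (w j) e) := by
    rw [← Finset.prod_filter_mul_prod_filter_not Finset.univ (fun j => j ∈ J)]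
    have h1 : Finset.univ.filter (fun j => j ∈ J) = J := by ext j; simp
    rw [h1]
    have h2 : ∏ j ∈ Finset.univ.filter (fun j => ¬ j ∈ J), ∑ e ∈ B j, monomial e (hatCoeff (w j) e) = 1 := by
      refine Finset.prod_eq_one fun j hj => ?_
      have hj' : j ∉ J := (Finset.mem_filter.1 hj).2
      simp [hB, hj', hatCoeff]
    rw [h2, mul_one]
    refine Finset.prod_congr rfl fun j hj => ?_
    have hBj : B j = A := by simp [hB, hj]
    rw [hBj]
    -- `w j = Σ_{e ∈ A} ŵ_j(e) X^e`
    have h3 : ∑ e ∈ A, monomial e (hatCoeff (w j) e) = ∑ e ∈ A, monomial e (coeff e (w j)) := by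
      refine Finset.sum_congr rfl fun e he => ?_
      have hne : e ≠ 0 := fun h => h0 (h ▸ he)
      simp [hatCoeff, hne]
    rw [h3, ← Finset.sum_subset (hw j)]
    · exact (w j).as_sum
    · intro e _ he
      rw [notMem_support_iff.1 he, map_zero]
  rw [hprod, Finset.prod_univ_sum]
  -- the index sets agree: `piFinset B` = tuples over `A ∪ {0}` supported exactly on `J`
  have hidx : Fintype.piFinset B = (Fintype.piFinset fun _ : Fin m => insert (0 : Expo) A).filter
      (fun b => (Finset.univ.filter fun j => b j ≠ 0) = J) := by
    ext b
    simp only [Fintype.mem_piFinset, Finset.mem_filter, hB]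
    constructor
    · intro hb
      refine ⟨fun j => ?_, ?_⟩
      · have := hb j
        split_ifs at this with hj
        · exact Finset.mem_insert_of_mem this
        · rw [Finset.mem_singleton] at this
          rw [this]
          exact Finset.mem_insert_self _ _
      · ext j
        simp only [Finset.mem_filter, Finset.mem_univ, true_and]
        have := hb j
        split_ifs at this with hj
        · exact ⟨fun _ => hj, fun _ h => h0 (h ▸ this)⟩
        · rw [Finset.mem_singleton] at this
          exact ⟨fun h => absurd this h, fun h => absurd h hj⟩
    · rintro ⟨hb, hJ⟩ j
      have hbj := hb j
      split_ifs with hj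
      · rw [← hJ] at hj
        have hne : b j ≠ 0 := (Finset.mem_filter.1 hj).2
        exact (Finset.mem_insert.1 hbj).resolve_left hne
      · rw [← hJ] at hj
        have : ¬ b j ≠ 0 := fun h => hj (Finset.mem_filter.2 ⟨Finset.mem_univ _, h⟩)
        push Not at this
        rw [this]
        exact Finset.mem_singleton_self _
  rw [hidx]
  refine Finset.sum_congr rfl fun b _ => ?_
  rw [monomial_sum_prod]

/-- **GRADED PRODUCT EXPANSION.**  The elementary symmetric polynomial of the tails `Σ_{|J| = r} ∏_{j∈J} w_j` is the sum of the
tuple monomials `(∏_j ŵ_j(b_j)) X^{Σ_j b_j}` over the letter tuples with exactly `r` non-zero slots. [folklore] -/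
theorem esymm_eq_sum_tuples (w : Fin m → MvPolynomial (Fin 2) ℂ) (A : Finset Expo) (h0 : (0 : Expo) ∉ A)
    (hw : ∀ j, (w j).support ⊆ A) (r : ℕ) :
    ∑ J ∈ (Finset.univ : Finset (Fin m)).powersetCard r, ∏ j ∈ J, w j =
      ∑ b ∈ (Fintype.piFinset fun _ : Fin m => insert (0 : Expo) A).filter
        (fun b => (Finset.univ.filter fun j => b j ≠ 0).card = r), monomial (∑ j, b j) (∏ j, hatCoeff (w j) (b j)) := by
  classical
  set Tup := (Fintype.piFinset fun _ : Fin m => insert (0 : Expo) A) with hTup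
  set S := Tup.filter (fun b => (Finset.univ.filter fun j => b j ≠ 0).card = r) with hS
  -- fiberwise by the support set
  have hmaps : ∀ b ∈ S, (Finset.univ.filter fun j => b j ≠ 0) ∈ (Finset.univ : Finset (Fin m)).powersetCard r := by
    intro b hb
    rw [Finset.mem_powersetCard]
    exact ⟨Finset.filter_subset _ _, (Finset.mem_filter.1 hb).2⟩
  rw [← Finset.sum_fiberwise_of_maps_to hmaps]
  refine Finset.sum_congr rfl fun J hJ => ?_
  rw [prod_eq_sum_tuples w A h0 hw J]
  refine Finset.sum_congr ?_ fun _ _ => rfl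
  ext b
  simp only [Finset.mem_filter, hS, hTup]
  constructor
  · rintro ⟨hb, hbJ⟩
    refine ⟨⟨hb, ?_⟩, hbJ⟩
    rw [hbJ]
    exact (Finset.mem_powersetCard.1 hJ).2
  · rintro ⟨⟨hb, -⟩, hbJ⟩
    exact ⟨hb, hbJ⟩

/-- **Graded fibre sums.**  The coefficient at `p` of `Σ_{|J| = r} ∏_{j∈J} w_j` is the sum of the tuple weights over the tuples with
point `p` and exactly `r` non-zero slots. [folklore] -/
theorem coeff_esymm_eq_fibreSum (w : Fin m → MvPolynomial (Fin 2) ℂ) (A : Finset Expo) (h0 : (0 : Expo) ∉ A)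
    (hw : ∀ j, (w j).support ⊆ A) (r : ℕ) (p : Expo) :
    coeff p (∑ J ∈ (Finset.univ : Finset (Fin m)).powersetCard r, ∏ j ∈ J, w j) =
      ∑ b ∈ ((Fintype.piFinset fun _ : Fin m => insert (0 : Expo) A).filter
        (fun b => (Finset.univ.filter fun j => b j ≠ 0).card = r)).filter (fun b => ∑ j, b j = p),
          ∏ j, hatCoeff (w j) (b j) := by
  classical
  rw [esymm_eq_sum_tuples w A h0 hw r, coeff_sum]
  conv_rhs => rw [Finset.sum_filter]
  refine Finset.sum_congr rfl fun b _ => ?_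
  rw [coeff_monomial]

/-- Rearranging a tuple by a permutation of the positions preserves the number of non-zero slots. [folklore] -/
theorem card_support_comp_perm (a b : Fin m → Expo) (σ : Equiv.Perm (Fin m)) (h : ∀ j, b j = a (σ j)) :
    (Finset.univ.filter fun j => b j ≠ 0).card = (Finset.univ.filter fun j => a j ≠ 0).card := by
  classical
  refine Finset.card_equiv σ fun j => ?_
  simp only [Finset.mem_filter, Finset.mem_univ, true_and, h j]

end Summit.ValiantsHypothesis.ValiantsHypothesis.Theorems.NewtonUnitEquations.TwoProducts.Submerged

end
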